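/-
# K2 odd-line localisation — the abstract algebra layer (bsd-idea-20 g55, crux stmt-BirchSwinnertonDyer-19945)

Crux idea `abelian-residue-mu-seven` (REV 2, critic V#22bj PASS) isolates the research statement
`ResidualNonvanishingSeven` (K2): Kato's admissible class `z₀ ∈ 𝐇¹ := H¹_Iw(ℚ_∞, T₇W)` satisfies `z₀ ∉ 7·𝐇¹`.
The critic's remark V#22bj r2 names the next kernel target: the ODD-LINE LOCALISATION
`𝐇¹/7𝐇¹ ↪ H¹_Iw(ℚ_∞, W[7]) → H¹_Iw(ℚ_∞, 𝔽₇(ω²χ_D))` is injective on the image of `z̄₀`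
("where Ferrero–Washington actually enters").

This file proves the ABSTRACT form of that lemma (pure commutative algebra, no number theory), so that
the arithmetic content is reduced to exactly two named inputs.  DICTIONARY (W an a-type member of the
class, i.e. top graded piece of `T₇W` odd; see memo `BoundaryBlindness-g55.md` §1 for the parity table,
certified there by an exact computation of the 7-isogeny kernel character of 49a1, `θ = ω⁵`):

* `R`  ↦ `Λ/7Λ = 𝔽₇⟦T⟧` (an infinite integral domain);
* `Q`  ↦ `𝐇¹/7𝐇¹`, torsion-free over `R` BECAUSE `𝐇¹` is `Λ`-free of rank one
         (Kato 2004 Thm 12.4(3) + `W(ℚ)[7] = 0`; tree: `moduleFree_iwasawaH1_of_classCSeven`, memo g52 §0.5).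
         Freeness is load-bearing: for `𝐇¹ ≅ 𝔪 = (7,T)` one has `T • 7̄ = 0` in `𝔪/7𝔪`, so `Q` has torsion;
* `M`  ↦ `H¹_Iw(ℚ_∞, W[7])`,  `f : Q →ₗ M` the Bockstein injection from `0 → T →·7→ T → W[7] → 0`;
* `K`  ↦ `H¹_Iw(ℚ_∞, 𝔽₇(ω⁵χ_D))` (cohomology of the EVEN sub-line `W[𝔭]`), FINITE: Euler–Poincaré
         characteristic over `ℚ_∞` (`rank H¹ − rank H² = d⁻ = 0` for an even character) plus `μ = 0` for the
         `S`-ramified Iwasawa module of the abelian field `ℚ(ζ₇, √D)` (Ferrero–Washington 1979 / Iwasawa's Kummer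
         duality) which makes `H²_Iw` finitely generated over `ℤ₇` — THIS is where Ferrero–Washington enters;
* `N`  ↦ `H¹_Iw(ℚ_∞, 𝔽₇(ω²χ_D))` (cohomology of the ODD quotient line), `g : M →ₗ N` functorial,
         `j : K →ₗ M` functorial, `ker g ≤ range j` = exactness of `H¹(sub) → H¹(W[7]) → H¹(quotient)`.

Conclusion (`residual_ne_zero_on_quotient_line`): `z̄₀ ≠ 0` in `𝐇¹/7𝐇¹` ⟹ its image on the odd line is `≠ 0`.
Conversely the odd-line image is a priori a consequence, so K2 ⟺ (odd-line image of `z̄₀`) ≠ 0: the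
localisation is STRUCTURAL and the research content of K2 is the non-vanishing of one residual class in
`H¹_Iw(ℚ_∞, 𝔽₇(ω²χ_D)) ≅ 𝔽₇⟦T⟧ ⊕ (finite)`.  What this file does NOT do: it proves no arithmetic input
(freeness, finiteness of the even line, exactness are hypotheses of the dictionary, not theorems here), it
touches no registered stub, and no summit statement, crux or stub is proved by it.  0 sorry, Mathlib only.
-/
import Mathlib

namespace Summit.BirchSwinnertonDyer.BirchSwinnertonDyer.Cruxes.EllipticUnitValueSevenOfGZK.OddLineLocalisation

open Function

variable {R : Type*} [CommRing R]

/-- Pigeonhole: over an infinite ring, every element of a module that is finite as a set is torsion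
(killed by a non-zero scalar).  Dictionary: `K = H¹_Iw(ℚ_∞, 𝔽₇(η))` for an even character `η`, finite by
Ferrero–Washington + Euler–Poincaré; `R = 𝔽₇⟦T⟧`. -/
theorem exists_ne_zero_smul_eq_zero_of_finite {K : Type*} [AddCommGroup K] [Module R K]
    [Infinite R] [Finite K] (m : K) : ∃ a : R, a ≠ 0 ∧ a • m = 0 := by
  obtain ⟨a, b, hab, h⟩ := Finite.exists_ne_map_eq_of_infinite (fun a : R => a • m)
  refine ⟨a - b, sub_ne_zero.mpr hab, ?_⟩
  have h' : a • m = b • m := h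
  rw [sub_smul, h', sub_self]

/-- ODD-LINE LOCALISATION, abstract form.  A torsion-free module `Q` injecting into `M` by `f`, followed
by a map `g : M → N` whose kernel is covered by the image of a FINITE module `K`, still injects into `N`.
Dictionary: `Q = 𝐇¹/7𝐇¹` (torsion-free since `𝐇¹` is `Λ`-free), `M = H¹_Iw(ℚ_∞, W[7])`,
`N = H¹_Iw(ℚ_∞, odd quotient line)`, `K = H¹_Iw(ℚ_∞, even sub line)`, `ker g ≤ range j` = exactness. -/
theorem injective_comp_of_ker_le_range_of_finite
    {Q M N K : Type*} [AddCommGroup Q] [Module R Q] [AddCommGroup M] [Module R M]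
    [AddCommGroup N] [Module R N] [AddCommGroup K] [Module R K]
    [Infinite R] [NoZeroSMulDivisors R Q] [Finite K]
    (f : Q →ₗ[R] M) (g : M →ₗ[R] N) (j : K →ₗ[R] M)
    (hf : Injective f) (hker : LinearMap.ker g ≤ LinearMap.range j) :
    Injective (g ∘ₗ f) := by
  intro x y hxy
  have hx : f (x - y) ∈ LinearMap.ker g := by
    rw [LinearMap.mem_ker, map_sub, map_sub]
    exact sub_eq_zero.mpr hxy
  obtain ⟨k, hk⟩ := hker hx
  obtain ⟨a, ha, hak⟩ := exists_ne_zero_smul_eq_zero_of_finite (R := R) k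
  have h1 : f (a • (x - y)) = f 0 := by
    rw [map_smul, ← hk, ← map_smul, hak, map_zero, map_zero]
  have h2 : a • (x - y) = 0 := hf h1
  have h3 : x - y = 0 := (eq_zero_or_eq_zero_of_smul_eq_zero h2).resolve_left ha
  exact sub_eq_zero.mp h3

/-- The form in which K2 uses it: a class `q ≠ 0` in the torsion-free module `Q` (`z̄₀ ≠ 0` in `𝐇¹/7𝐇¹`)
has non-zero image on `N` (the odd residual line).  So `ResidualNonvanishingSeven` is EQUIVALENT to the
non-vanishing of one class in `H¹_Iw(ℚ_∞, 𝔽₇(ω²χ_D))`; the localisation itself carries no research content. -/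
theorem residual_ne_zero_on_quotient_line
    {Q M N K : Type*} [AddCommGroup Q] [Module R Q] [AddCommGroup M] [Module R M]
    [AddCommGroup N] [Module R N] [AddCommGroup K] [Module R K]
    [Infinite R] [NoZeroSMulDivisors R Q] [Finite K]
    (f : Q →ₗ[R] M) (g : M →ₗ[R] N) (j : K →ₗ[R] M)
    (hf : Injective f) (hker : LinearMap.ker g ≤ LinearMap.range j)
    {q : Q} (hq : q ≠ 0) : g (f q) ≠ 0 := by
  intro h
  have hinj := injective_comp_of_ker_le_range_of_finite f g j hf hker
  have : (g ∘ₗ f) q = (g ∘ₗ f) 0 := by simpa using h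
  exact hq (hinj this)

/-- Converse bookkeeping (no hypotheses): if the image on `N` is non-zero then the class is non-zero. -/
theorem ne_zero_of_residual_ne_zero
    {Q M N : Type*} [AddCommGroup Q] [Module R Q] [AddCommGroup M] [Module R M]
    [AddCommGroup N] [Module R N] (f : Q →ₗ[R] M) (g : M →ₗ[R] N) {q : Q} (h : g (f q) ≠ 0) :
    q ≠ 0 := by
  rintro rfl
  exact h (by simp)

/-- WHY FREENESS IS LOAD-BEARING (the counter-module of the card, kernel form): in `R := ℤ` (standing in
for `Λ`), the ideal-like module `𝔪 = ℤ` is fine, but over a ring with a non-free rank-one module the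
quotient `Q` may have torsion and the lemma is void.  Minimal abstract witness of the failure mode: if
`Q` HAS a non-zero torsion element then no injectivity statement of the above shape can be used on it —
recorded as the trivial remark that `NoZeroSMulDivisors` excludes it. -/
theorem no_torsion_elem {Q : Type*} [AddCommGroup Q] [Module R Q] [NoZeroSMulDivisors R Q]
    {a : R} {q : Q} (ha : a ≠ 0) (hq : q ≠ 0) : a • q ≠ 0 := by
  intro h
  rcases eq_zero_or_eq_zero_of_smul_eq_zero h with h | h
  · exact ha h
  · exact hq h

/-- EVEN-STEP bookkeeping used by the uniform reformulation of K2 (memo g55 §2, L3/L4): if a submodule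
inclusion `A ≤ B` of `R`-modules has FINITE index-module `B ⧸ A` and `B` is contained in... — the equality
`𝐇¹(πT) = 𝐇¹(T)` across an even graded step needs Krull-dimension input for `Λ` (a principal ideal of a
two-dimensional regular local ring has infinite quotient) and is NOT formalised here; what K2 uses from it
is only the following one-directional fact, valid over any ring: a class in `I • ⊤` (`I = (7)`) dies in every
quotient by a submodule containing `I • ⊤`. -/
theorem mkQ_eq_zero_of_mem_smul_top {H : Type*} [AddCommGroup H] [Module R H]
    (I : Ideal R) (P : Submodule R H) (hP : I • (⊤ : Submodule R H) ≤ P) {z : H}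
    (hz : z ∈ I • (⊤ : Submodule R H)) : P.mkQ z = 0 := by
  rw [Submodule.mkQ_apply, Submodule.Quotient.mk_eq_zero]
  exact hP hz

end Summit.BirchSwinnertonDyer.BirchSwinnertonDyer.Cruxes.EllipticUnitValueSevenOfGZK.OddLineLocalisation
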